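import Summits.PneNP.PneNP.Theorems.ExpanderLinearGeneratorsTransferPrep

/-!
# PneNP / ExpanderLinearGenerators — `LinearGeneratorDepthFregeHard` when the light variables
carry the expansion

Route `PneNP/ExpanderLinearGenerators`, crux stmt-PneNP-11443
(`Summit.PneNP.PneNP.Theses.ExpanderLinearGenerators.LinearGeneratorDepthFregeHard`). Call a
variable of a system `E` over `𝔽₂` LIGHT if it occurs in at most two equations and HEAVY
otherwise. The column-weight-`≤ 2` slice of the crux
(`ColumnTwo.linearGeneratorDepthFregeHard_of_colWeight_le_two`: all variables light) extends to
every `ℓ`-sparse unsolvable system whose LIGHT PARTS of the row supports alone form an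
`(n^{1-δ}, 3ℓ/4)`-boundary expander, heavy variables being arbitrary: substituting `0` for the
heavy variables is a restriction, it maps a depth-`d` refutation of `sumEncoding 1 E` to a
depth-`(d + 16)` refutation of the XOR-CNF of the restricted system (GIRS transfer,
`LinGen.exists_xorProof_of_rowLocal`), and the restricted system has column weight `≤ 2`, the
light supports, and no solution. Since a light variable lies in exactly one light part iff it lies
in exactly one support, the hypothesis implies the crux's own expansion hypothesis, so this is a
slice of the crux strictly containing the column-weight-two slice; what it leaves open is exactly
the case where the expansion genuinely needs heavy (hyperedge) variables.

* `supp_restrict`, `systemSat_of_restrict`, `holds_restrict_iff` — restriction to zero outside a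
  variable set `L`;
* `exists_xorProof_of_restrict` — a refutation of `E` yields one of the restricted system;
* `linearGeneratorDepthFregeHard_of_light_expansion` — the slice.

References: J. Krajíček, *Proof complexity* (CUP 2019), Problem 19.4.5; N. Galesi, D. Itsykson,
A. Riazanov, A. Sofronova, APAL 174 (2023), Lemma 10 and §3.1 (restrictions as substitutions);
A. Urquhart, X. Fu, NDJFL 37 (1996); E. Ben-Sasson, Comput. Complexity 11 (2002).
-/

namespace Summit.PneNP.PneNP.Theorems.LinGen

open Filter Finset Literature.Computability.MetaComplexity
open Literature.Computability.MetaComplexity.TextbookFrege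
open Literature.Computability.Complexity (PropForm Clause CNF Literal)
open Literature.Computability.Complexity.PropForm
open Literature.Computability.MetaComplexity.KrajicekRamsey (clauseOf ofCNF_eq_conjList)
open Summit.PneNP.PneNP.Theorems.GridRouting Summit.PneNP.PneNP.Theorems.ColumnTwo

variable {m n : ℕ}

/-! ### Restriction to zero outside a set of variables -/

section Restrict

variable {L : Finset (Fin n)} {E E' : Fin m → LinEqMod 2 n}
  (hE' : ∀ i j, (E' i).1 j = if j ∈ L then (E i).1 j else 0)

include hE'

/-- The support of a restricted equation is the kept part of the support. [folklore] -/
theorem supp_restrict (i : Fin m) : (E' i).supp = (E i).supp.filter fun j => j ∈ L := by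
  ext j
  simp only [LinEqMod.supp, Finset.mem_filter, Finset.mem_univ, true_and, hE' i j]
  by_cases h : j ∈ L <;> simp [h]

/-- Restriction does not increase supports. [folklore] -/
theorem card_supp_restrict_le (i : Fin m) : (E' i).supp.card ≤ (E i).supp.card := by
  rw [supp_restrict hE' i]
  exact Finset.card_filter_le _ _

/-- **A solution of the restricted system extends by zero to a solution of the system.**
[folklore] -/
theorem systemSat_of_restrict (hb : ∀ i, (E' i).2 = (E i).2) (h : SystemSat E' Finset.univ) :
    SystemSat E Finset.univ := by
  classical
  obtain ⟨z, hz⟩ := h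
  refine ⟨fun j => if j ∈ L then z j else 0, fun i _ => ?_⟩
  have h1 := hz i (Finset.mem_univ _)
  unfold LinEqMod.Holds at h1 ⊢
  rw [← hb i, ← h1]
  refine Finset.sum_congr rfl fun j _ => ?_
  rw [hE' i j]
  by_cases hj : j ∈ L <;> simp [hj]

/-- **The restricted equation under `τ` is the equation under `τ` killed outside `L`.**
[folklore] -/
theorem holds_restrict_iff (hb : ∀ i, (E' i).2 = (E i).2) (τ : ℕ → Bool) (i : Fin m) :
    (E' i).Holds (blockVals 2 1 n τ) ↔
      (E i).Holds (blockVals 2 1 n fun x =>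
        if h : x < n then (if (⟨x, h⟩ : Fin n) ∈ L then τ x else false) else τ x) := by
  rw [holds_blockVals_iff, holds_blockVals_iff, hb i]
  have : ∀ j : Fin n, (E' i).1 j * (if τ j then (1 : ZMod 2) else 0) =
      (E i).1 j * (if (if h : (j : ℕ) < n then (if (⟨j, h⟩ : Fin n) ∈ L then τ j else false)
        else τ j) then (1 : ZMod 2) else 0) := by
    intro j
    rw [hE' i j, dif_pos j.2]
    simp only [Fin.eta]
    by_cases hj : j ∈ L <;> simp [hj]
  rw [Finset.sum_congr rfl fun j _ => this j]

/-- **A refutation of the system yields a refutation of the restricted system** (substitute `⊥`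
for the variables outside `L`): depth `d + 16`, size the GIRS transfer bound at
`Z = S + m · 2^ℓ (3ℓ+2)`. [Galesi–Itsykson–Riazanov–Sofronova 2023, Lemma 10, §3.1] -/
theorem exists_xorProof_of_restrict {d ℓ : ℕ} {π : List (PropForm ℕ)}
    (hb : ∀ i, (E' i).2 = (E i).2) (hℓ : ∀ i, (E i).supp.card ≤ ℓ)
    (hπ : textbookFrege.IsDepthProofOf d π (neg (PropForm.ofCNF (sumEncoding 1 E)))) :
    ∃ π', textbookFrege.IsDepthProofOf (d + 16) π' (neg (PropForm.ofCNF (sumEncoding 1 E'))) ∧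
      proofSize π' ≤ transferLines (proofSize π) (proofSize π + m * (2 ^ ℓ * (3 * ℓ + 2))) (2 ^ ℓ) ℓ *
        (40 * ((2 ^ ℓ + 3) * (proofSize π + m * (2 ^ ℓ * (3 * ℓ + 2)) + 3) + ℓ) + 300) := by
  classical
  -- the killing substitution and the killed assignment
  set σ : ℕ → PropForm ℕ := fun x =>
    if h : x < n then (if (⟨x, h⟩ : Fin n) ∈ L then var x else const false) else var x with hσ
  have hσeval : ∀ (τ : ℕ → Bool) (x : ℕ), (σ x).eval τ =
      (if h : x < n then (if (⟨x, h⟩ : Fin n) ∈ L then τ x else false) else τ x) := by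
    intro τ x
    simp only [hσ]
    split_ifs <;> simp [PropForm.eval]
  have hℓ' : ∀ i, (E' i).supp.card ≤ ℓ := fun i => (card_supp_restrict_le hE' i).trans (hℓ i)
  refine exists_xorProof_of_rowLocal (sumEncoding 1 E) E' σ
    (fun x => by simp only [hσ]; split_ifs <;> simp [size])
    (fun x c => by simp only [hσ]; split_ifs <;> simp [altDepthAux]) hℓ' hπ ?_
  intro c hc
  simp only [sumEncoding, List.mem_flatMap, List.mem_finRange, true_and] at hc
  obtain ⟨i, hi⟩ := hc
  refine ⟨i, fun x hx => ?_, fun τ hτ => ?_⟩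
  · -- variables of the killed clause are kept variables of the row
    obtain ⟨y, hy, hxy⟩ := mem_vars_subst hx
    obtain ⟨l, hl, rfl⟩ := exists_literal_of_mem_vars_clauseOf hy
    have hv : l.1 ∈ eqVars 1 (E i) := by
      rw [equationCNF] at hi
      exact fst_mem_of_mem_canonicalCNF hi hl
    obtain ⟨j, hj, hlj⟩ := mem_eqVars.1 hv
    obtain ⟨j0, hj0, hl1⟩ := mem_encBlock.1 hlj
    have hl1' : l.1 = (j : ℕ) := by omega
    rw [hl1'] at hxy
    simp only [hσ, dif_pos j.2, Fin.eta] at hxy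
    by_cases hjL : j ∈ L
    · rw [if_pos hjL] at hxy
      simp only [PropForm.vars, Finset.mem_singleton] at hxy
      subst hxy
      refine mem_eqVars.2 ⟨j, ?_, mem_encBlock.2 ⟨0, one_pos, by simp⟩⟩
      rw [supp_restrict hE' i, Finset.mem_filter]
      exact ⟨hj, hjL⟩
    · rw [if_neg hjL] at hxy
      simp [PropForm.vars] at hxy
  · -- a killed clause of row `i` is true once the restricted equation of `i` holds
    rw [eval_subst, OntoPHPReduction.eval_clauseOf]
    have hfun : (fun x => (σ x).eval τ) =
        fun x => (if h : x < n then (if (⟨x, h⟩ : Fin n) ∈ L then τ x else false) else τ x) :=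
      funext (hσeval τ)
    rw [hfun]
    have hholds := (holds_restrict_iff hE' hb τ i).1 hτ
    have hall := eval_equationCNF 1 (E i)
      (fun x => if h : x < n then (if (⟨x, h⟩ : Fin n) ∈ L then τ x else false) else τ x)
    rw [decide_eq_true hholds, CNF.eval_eq_true_iff] at hall
    exact hall c hi

end Restrict

/-! ### The slice -/

/-- **`LinearGeneratorDepthFregeHard` when the light variables carry the expansion.** For every
`ℓ ≥ 1`, `0 < δ < 1` and depth `d` there are `ε > 0` and `N` such that for `n ≥ N`: every
`ℓ`-sparse unsolvable system `E : Fin m → LinEqMod 2 n` over `𝔽₂` such that the LIGHT PARTS of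
its row supports — the variables of the support occurring in at most two equations — form an
`(n^{1-δ}, 3ℓ/4)`-boundary expander has no depth-`d` `textbookFrege` proof of
`¬(sumEncoding 1 E)` of size `< 2^{n^ε}`. (The hypothesis implies the crux's expansion hypothesis;
with no heavy variable it is `ColumnTwo.linearGeneratorDepthFregeHard_of_colWeight_le_two`.)
Proof: restrict the heavy variables to `0` (GIRS transfer of the refutation,
`exists_xorProof_of_restrict`); the restricted system has column weight `≤ 2`, the light supports
and no solution, so the column-weight-two theorem applies at depth `d + 16`; polynomial size
bookkeeping (`lb_of_poly`). [Krajíček 2019, Problem 19.4.5; Galesi et al. 2023, Lemma 10;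
Urquhart–Fu 1996; Ben-Sasson 2002] -/
theorem linearGeneratorDepthFregeHard_of_light_expansion :
    ∀ (ℓ d : ℕ) (δ : ℝ), 1 ≤ ℓ → 0 < δ → δ < 1 → ∃ ε : ℝ, 0 < ε ∧ ∃ N : ℕ, ∀ n : ℕ, N ≤ n →
      ∀ (m : ℕ) (E : Fin m → LinEqMod 2 n),
      (∀ i, (E i).supp.card ≤ ℓ) →
      IsBoundaryExpander
        (fun i => ((E i).supp.filter fun j =>
          (Finset.univ.filter fun i' => j ∈ (E i').supp).card ≤ 2).map Fin.valEmbedding)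
        ((n : ℝ) ^ (1 - δ)) (3 / 4 * ℓ) →
      ¬ SystemSat E Finset.univ →
      ∀ π : List (PropForm ℕ),
        textbookFrege.IsDepthProofOf d π (PropForm.neg (PropForm.ofCNF (sumEncoding 1 E))) →
          (2 : ℝ) ^ ((n : ℝ) ^ ε) ≤ (proofSize π : ℝ) := by
  intro ℓ d δ hℓ hδ hδ1
  obtain ⟨ε, hε, N₁, hN₁⟩ :=
    ColumnTwo.linearGeneratorDepthFregeHard_of_colWeight_le_two ℓ (d + 16) δ hℓ hδ hδ1
  obtain ⟨Cst, hCst, hbound⟩ := transferBound_poly (2 ^ ℓ) ℓ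
  set W : ℕ := 2 ^ ℓ * (3 * ℓ + 2) with hW
  obtain ⟨N₂, hN₂⟩ := eventually_atTop.1 (eventually_lb_params (max (2 * W) (8 * Cst)) hε)
  refine ⟨ε / 2, by positivity, max N₁ N₂, ?_⟩
  intro n hn m E hsparse hexp hunsat π hπ
  obtain ⟨hc1, hc2, h4, hn1⟩ := hN₂ n (le_trans (le_max_right _ _) hn)
  classical
  -- the light variables and the restricted system
  set L : Finset (Fin n) := Finset.univ.filter fun j =>
    (Finset.univ.filter fun i' => j ∈ (E i').supp).card ≤ 2 with hL
  set E' : Fin m → LinEqMod 2 n := fun i => (fun j => if j ∈ L then (E i).1 j else 0, (E i).2)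
    with hE'def
  have hE' : ∀ i j, (E' i).1 j = if j ∈ L then (E i).1 j else 0 := fun i j => rfl
  have hb : ∀ i, (E' i).2 = (E i).2 := fun i => rfl
  have hsuppE' : ∀ i, (E' i).supp = (E i).supp.filter fun j =>
      (Finset.univ.filter fun i' => j ∈ (E i').supp).card ≤ 2 := by
    intro i
    rw [supp_restrict hE' i]
    refine Finset.filter_congr fun j _ => ?_
    simp [hL]
  have hcol : ∀ j : Fin n, (Finset.univ.filter fun i => j ∈ (E' i).supp).card ≤ 2 := by
    intro j
    by_cases hj : (Finset.univ.filter fun i' => j ∈ (E i').supp).card ≤ 2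
    · refine le_trans (Finset.card_le_card ?_) hj
      intro i hi
      simp only [Finset.mem_filter, Finset.mem_univ, true_and] at hi ⊢
      rw [hsuppE' i, Finset.mem_filter] at hi
      exact hi.1
    · have : (Finset.univ.filter fun i => j ∈ (E' i).supp) = ∅ := by
        refine Finset.filter_eq_empty_iff.2 fun i _ hi => ?_
        rw [hsuppE' i, Finset.mem_filter] at hi
        exact hj hi.2
      rw [this, Finset.card_empty]
      omega
  have hℓ' : ∀ i, (E' i).supp.card ≤ ℓ := fun i => (card_supp_restrict_le hE' i).trans (hsparse i)
  have hexp' : IsBoundaryExpander (fun i => (E' i).supp.map Fin.valEmbedding) ((n : ℝ) ^ (1 - δ))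
      (3 / 4 * ℓ) := by
    have : (fun i => (E' i).supp.map Fin.valEmbedding) = fun i => ((E i).supp.filter fun j =>
        (Finset.univ.filter fun i' => j ∈ (E i').supp).card ≤ 2).map Fin.valEmbedding :=
      funext fun i => by rw [hsuppE' i]
    rw [this]
    exact hexp
  have hunsat' : ¬ SystemSat E' Finset.univ := fun h => hunsat (systemSat_of_restrict hE' hb h)
  -- transfer of the refutation and the column-weight-two theorem
  obtain ⟨π', hπ', hsize⟩ := exists_xorProof_of_restrict hE' hb hsparse hπ
  have hlb := hN₁ n (le_trans (le_max_left _ _) hn) m E' hcol hℓ' hexp' hunsat' π' hπ'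
  -- sizes: `m ≤ 2n`
  have hn1' : (1 : ℝ) ≤ (n : ℝ) ^ (1 - δ) :=
    Real.one_le_rpow (by exact_mod_cast hn1) (by linarith)
  have hdeg : ∀ i, 0 < (E' i).supp.card := fun i => by
    have := hexp'.card_pos (mul_pos (by norm_num) (by exact_mod_cast hℓ)) hn1' i
    rwa [Finset.card_map] at this
  have hm2n : m ≤ 2 * n := card_rows_le E' hcol hdeg
  set S := proofSize π with hS
  have hsz : proofSize π' ≤ Cst * (1 * S + 2 * W * n + 3) ^ 3 := by
    refine hsize.trans ((hbound S (S + m * W) (Nat.le_add_right _ _)).trans ?_)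
    refine Nat.mul_le_mul_left _ (Nat.pow_le_pow_left ?_ 3)
    have := Nat.mul_le_mul_right W hm2n
    nlinarith
  refine lb_of_poly (ε := ε) (ε' := ε / 2) (T := Cst) (a := 1) (b := 2 * W * n) hlb hsz ?_ ?_ h4
  · have h2W : ((2 * W : ℕ) : ℝ) ≤ ((max (2 * W) (8 * Cst) : ℕ) : ℝ) := by
      exact_mod_cast le_max_left _ _
    have hn0 : (0 : ℝ) ≤ n := Nat.cast_nonneg n
    push_cast at hc1 h2W ⊢
    nlinarith
  · have h8 : ((8 * Cst : ℕ) : ℝ) ≤ ((max (2 * W) (8 * Cst) : ℕ) : ℝ) := by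
      exact_mod_cast le_max_right _ _
    push_cast at hc2 h8 ⊢
    nlinarith

end Summit.PneNP.PneNP.Theorems.LinGen
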